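import Summits.Ventures.CertifiedManyBodySolver.Certificates.HubbardSquare_n4o5_stiffness_chordPlaneStation_r715_points_A
import Summits.Ventures.CertifiedManyBodySolver.Observables.StiffnessParticleHoleMirror
import HarnessLib
import HarnessLib.Audit

/-!
# Ventures/CertifiedManyBodySolver — Certificates/HubbardSquare_n4o5_stiffness_chordPlaneStation_twins6o5_r715_points_A.lean

HONEST FRAMING: the ELECTRON-DOPED `n = 6/5` particle–hole TWINS (`10 ∣ L`, `(t′, 4/5) ↦ (−t′, 6/5)`; `ObsStiffnessSeqCeilingAt.twin_six_div_five`) of the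
(N22) «⅘ t′ = 0 EDGE AT U ≤ 12 UNDER THE MEASURED #715 CAP» words of `Certificates/HubbardSquare_n4o5_stiffness_chordPlaneStation_r715_points_A.lean` (hubbard-fast-reuse-2 g20; 2 twins in this file):
same `U`, mirrored `t′` (here `t′ = 0 ↦ 0`), same constants. Dictionary class: one-sided stiffness CEILINGS, transport-only, conditional on EXACTLY the premises of their 4/5 originals
(registry nodes #589 / #553 BY NAME — #589 is the zero-weight partner of the single-floor vertex — and the CERTIFIED #715 strip-cell claim node `cert_stripcell2_W4SG9n45U12tp0D512_p8_cell` BY NAME).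
«other observable», Δε = 0; not registry rows; not a superconductivity or `T_c` verdict; NO summit statement is proved by this seat.
Zero compute, no definition, no new claim node, no `sorry`.
Cell `pub/hubbard-fast` (D-0154 (1)(A)), seat `hubbard-fast-reuse-2` g20.
References: E. H. Lieb, F. Y. Wu, Physica A 321 (2003) 1, §1 eq. (3) [LiebWuPhysicaA2003]; D. J. Scalapino, S. R. White, S.-C. Zhang, PRB 47 (1993) 7995, §II [ScalapinoWhiteZhang1993].
-/

noncomputable section

namespace Summit.Ventures.CertifiedManyBodySolver.Certificates

open Literature.MathematicalPhysics.QuantumLattice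
open Literature.MathematicalPhysics.QuantumLattice.ThermodynamicLimit
open Summit.Ventures.CertifiedManyBodySolver.Observables

/-- 6/5 twin of `n4o5_oblqCPr715Mix_U47o4_tp0_stiffnessWord_of`: the mirrored point `(47/4, 6/5, 0)` (`10 ∣ L`), `ρ_s ≤ 0.3465186`. [cite: LiebWuPhysicaA2003, §1 eq. (3)] -/
theorem n6o5_oblqCPr715Mix_U47o4_tp0_twin_of (h589 : cert_r589_bs_GU8n4o5tpm3o10_w3_b4_R2_ob5p2_kry1_kry2c3rel_hanK7B4D4_KN4_PR20d4_hanK8c2s_uprime) (h553 : cert_r553_bs_GU4n4o5tp0_w3_b4_R2_ob5p2_kry1_kry2c3rel_hanK7B4D4_KN4_PR20d4_hanK8c2s_uprime) (h715 : cert_stripcell2_W4SG9n45U12tp0D512_p8_cell) :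
    ObsStiffnessSeqCeilingOnMultiples 10 (0) (47/4) (6 / 5) (1732593/5000000) := by
  have h := (n4o5_oblqCPr715Mix_U47o4_tp0_stiffnessWord_of h589 h553 h715).twin_six_div_five
  norm_num at h ⊢
  exact h

/-- 6/5 twin of `n4o5_oblqCPr715Mix_U12_tp0_stiffnessWord_of`: the mirrored point `(12, 6/5, 0)` (`10 ∣ L`), `ρ_s ≤ 0.3447222`. [cite: LiebWuPhysicaA2003, §1 eq. (3)] -/
theorem n6o5_oblqCPr715Mix_U12_tp0_twin_of (h589 : cert_r589_bs_GU8n4o5tpm3o10_w3_b4_R2_ob5p2_kry1_kry2c3rel_hanK7B4D4_KN4_PR20d4_hanK8c2s_uprime) (h553 : cert_r553_bs_GU4n4o5tp0_w3_b4_R2_ob5p2_kry1_kry2c3rel_hanK7B4D4_KN4_PR20d4_hanK8c2s_uprime) (h715 : cert_stripcell2_W4SG9n45U12tp0D512_p8_cell) :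
    ObsStiffnessSeqCeilingOnMultiples 10 (0) (12) (6 / 5) (1723611/5000000) := by
  have h := (n4o5_oblqCPr715Mix_U12_tp0_stiffnessWord_of h589 h553 h715).twin_six_div_five
  norm_num at h ⊢
  exact h

end Summit.Ventures.CertifiedManyBodySolver.Certificates

end
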